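import Summits.Ventures.YMGap.FlowData.RectTubeFluxNonAnnihilation
import Summits.Ventures.YMGap.FlowData.SU2WeightCharacterSeries
import HarnessLib

/-!
# Venture YMGap, track Y3 FLOW-DATA — rectangular tubes: the polarised matrix element of a reproducing state, and the
# `SU(2)` CHARACTER HAAR CHAIN along an injective link family (`χ_n` of a line holonomy reproduces itself with the factor
# `c₀^{N−m} (c_n/(n+1))^m`) (theorems only)

HONEST FRAMING: venture file of the cell `pub-ymgap` (QuantumFields programme), track Y3; lemmas for the `e = 0` witness of
`FlowData/RectTubeMassGapPrimeWindow.lean` (the adjoint Polyakov loop).  Finite Haar integrals on a finite rectangular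
torus; no number, no row, nothing about `L → ∞`, the continuum or a mass gap.

* `inner_rectTubeTransferOperator_reproducingState_left` — for `g = e^{−J mag/2} V` (`V` continuous) and
  `f = e^{−J mag/2} W` with `W` continuous, gauge invariant and reproduced by the one-step Haar chain with factor `C`
  (`∫ ∏_e e^{J Re tr ρ(c_e)} W(c·a) dc = C·W(a)`): `⟪g, T f⟫ = C ∫ V·W` (general compact group; the temporal links gauge
  away, `RectTubePolyakovLine.integral_integral_exp_rectElecSum_mul`);
* `su2_integral_exp_mul_chebyshevU_mul` — one step: `∫ e^{b a₀(V)} U_n(a₀(V Q)) dV = (c_n(b)/(n+1)) U_n(a₀(Q))`, `b ≥ 0`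
  (`SU2WeightCharacterSeries.integral_weight_mul_su2Character`);
* **`su2_integral_prod_exp_mul_chebyshevU_chain`** — `∫ ∏ₜ e^{b a₀(cₜ)} U_n(a₀(X c₀a₀ ⋯ c_{m−1}a_{m−1} Y)) dc
  = (c_n(b)/(n+1))^m U_n(a₀(X a₀⋯a_{m−1} Y))` (induction, `measurePreserving_piFinSuccAbove`, cyclicity of `a₀`);
* **`su2_integral_prod_exp_mul_chebyshevU_rectLine`** — on the rectangular slice with an injective `ℓ : Fin m → links`:
  `∫ (∏_e e^{b a₀(c_e)}) U_n(a₀(∏ₜ c_{ℓ t} aₜ)) dc = (∫ e^{b a₀})^{N−m} (c_n(b)/(n+1))^m U_n(a₀(∏ₜ aₜ))`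
  (`slab_integral_pi_window_one`).

References: I. Montvay, G. Münster (1994) §3.2.6, §3.4.2 [cite: MontvayMunster1994, §3.2.6]; T. Bröcker, T. tom Dieck (1985)
II (4.8) [folklore].
-/

noncomputable section

open scoped BigOperators ENNReal
open MeasureTheory Filter Function Polynomial.Chebyshev
open Literature.MathematicalPhysics.QuantumFieldTheory Literature.Analysis.OperatorTheory Literature.Analysis.FunctionSpaces
open Literature.MathematicalPhysics.QuantumLattice (RectTorusSite)
open Summit.Ventures.LatticeQCDFlow.Exactness Summit.Ventures.LatticeQCDFlow.Scoring

namespace Summit.Ventures.YMGap.FlowData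

/-! ### The polarised matrix element of a reproducing state -/

section Reproducing

variable {G : Type*} [Group G] [TopologicalSpace G] [IsTopologicalGroup G] [CompactSpace G]
  [MeasurableSpace G] [BorelSpace G] [SecondCountableTopology G] {n k : ℕ} (ρ : G →* Matrix (Fin n) (Fin n) ℂ)
  (J : ℝ) {Ls : Fin k → ℕ} [∀ i, NeZero (Ls i)]

/-- **`⟪g, T f⟫ = C ∫ V·W`** for `g = e^{−J mag/2} V`, `f = e^{−J mag/2} W` (both square integrable), `W` continuous,
gauge invariant and reproduced by the one-step Haar chain with factor `C`. [cite: MontvayMunster1994, §3.2.6] -/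
theorem inner_rectTubeTransferOperator_reproducingState_left (hρ : Continuous ρ) {V W : RectSlice Ls G → ℝ}
    (hWc : Continuous W)
    (hWg : ∀ (γ : RectTorusSite Ls → G) (b : RectSlice Ls G),
      W (fun e => γ e.1 * b e * (γ (e.1 + Pi.single e.2 1))⁻¹) = W b)
    {C : ℝ} (hrep : ∀ a : RectSlice Ls G,
      ∫ c, (∏ e : RectTorusSite Ls × Fin k, Real.exp (J * (ρ (c e)).trace.re)) * W (c * a) ∂(rectSliceMeasure G Ls) =
        C * W a)
    (hmemV : MemLp (fun b : RectSlice Ls G => Real.exp (-(J / 2 * rectMagSum (Ls := Ls) ρ b)) * V b) 2 (rectSliceMeasure G Ls))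
    (hmemW : MemLp (fun b : RectSlice Ls G => Real.exp (-(J / 2 * rectMagSum (Ls := Ls) ρ b)) * W b) 2 (rectSliceMeasure G Ls)) :
    @inner ℝ _ _ (hmemV.toLp _) (rectTubeTransferOperator ρ J Ls (hmemW.toLp _)) =
      C * ∫ b, V b * W b ∂(rectSliceMeasure G Ls) := by
  set g : RectSlice Ls G → ℝ := fun b => Real.exp (-(J / 2 * rectMagSum (Ls := Ls) ρ b)) * V b with hg
  set f : RectSlice Ls G → ℝ := fun b => Real.exp (-(J / 2 * rectMagSum (Ls := Ls) ρ b)) * W b with hf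
  set ψ : Lp ℝ 2 (rectSliceMeasure G Ls) := hmemV.toLp _ with hψ
  set φ : Lp ℝ 2 (rectSliceMeasure G Ls) := hmemW.toLp _ with hφ
  rw [inner_kernelOp_eq_integral (rectTubeTransferOperator_ae_eq J Ls hρ) ψ φ]
  have haeψ : (ψ : RectSlice Ls G → ℝ) =ᵐ[rectSliceMeasure G Ls] g := hmemV.coeFn_toLp
  have haeφ : (φ : RectSlice Ls G → ℝ) =ᵐ[rectSliceMeasure G Ls] f := hmemW.coeFn_toLp
  have h1 : ∀ a, ∫ b, rectSliceKernel (Ls := Ls) ρ J J a b * φ b ∂(rectSliceMeasure G Ls) =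
      ∫ b, rectSliceKernel (Ls := Ls) ρ J J a b * f b ∂(rectSliceMeasure G Ls) := by
    intro a
    refine integral_congr_ae ?_
    filter_upwards [haeφ] with b hb
    rw [hb]
  have h2 : (fun a => ψ a * ∫ b, rectSliceKernel (Ls := Ls) ρ J J a b * φ b ∂(rectSliceMeasure G Ls))
      =ᵐ[rectSliceMeasure G Ls]
      fun a => g a * ∫ b, rectSliceKernel (Ls := Ls) ρ J J a b * f b ∂(rectSliceMeasure G Ls) := by
    filter_upwards [haeψ] with a ha
    rw [ha, h1 a]
  rw [integral_congr_ae h2]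
  have h3 : ∀ a, ∫ b, rectSliceKernel (Ls := Ls) ρ J J a b * f b ∂(rectSliceMeasure G Ls) =
      Real.exp (J / 2 * rectMagSum (Ls := Ls) ρ a) * (C * W a) := by
    intro a
    have hK : ∀ b, rectSliceKernel (Ls := Ls) ρ J J a b * f b = Real.exp (J / 2 * rectMagSum (Ls := Ls) ρ a) *
        ((∫ E, Real.exp (J * rectElecSum (Ls := Ls) ρ a E b)
          ∂(Measure.pi fun _ : RectTorusSite Ls => haarProbability G)) * W b) := by
      intro b
      simp only [rectSliceKernel, hf, Real.exp_neg]
      field_simp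
    simp_rw [hK]
    rw [integral_const_mul, integral_integral_exp_rectElecSum_mul ρ J hρ hWc hWg a, hrep a]
  simp_rw [h3]
  have h5 : ∀ a, g a * (Real.exp (J / 2 * rectMagSum (Ls := Ls) ρ a) * (C * W a)) = C * (V a * W a) := by
    intro a
    simp only [hg, Real.exp_neg]
    field_simp
  simp_rw [h5]
  rw [integral_const_mul]

end Reproducing

/-! ### The `SU(2)` character Haar chain -/

section SU2Chain

/-- **One step**: `∫ e^{b a₀(V)} U_n(a₀(V Q)) dV = (c_n(b)/(n+1)) U_n(a₀(Q))`, `b ≥ 0` (`a₀(V⁻¹) = a₀(V)`).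
[cite: MontvayMunster1994, §3.2.6] -/
theorem su2_integral_exp_mul_chebyshevU_mul {b : ℝ} (hb : 0 ≤ b) (n : ℕ) (Q : Matrix.specialUnitaryGroup (Fin 2) ℂ) :
    ∫ V, Real.exp (b * su2a0 V) * (U ℝ n).eval (su2a0 (V * Q)) ∂haarProbability (Matrix.specialUnitaryGroup (Fin 2) ℂ) =
      (besselI n b - besselI (n + 2) b) / (n + 1) * (U ℝ n).eval (su2a0 Q) := by
  have h := integral_weight_mul_su2Character hb n 1 Q
  simp only [one_mul, su2a0_inv] at h
  exact h

/-- **The `SU(2)` character Haar chain**: for `m` independent Haar link variables `c₀, …, c_{m−1}` weighted by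
`e^{b a₀}` (`b ≥ 0`) and any fixed `X, Y, a₀, …, a_{m−1}`,
`∫ ∏ₜ e^{b a₀(cₜ)} U_n(a₀(X c₀a₀ ⋯ c_{m−1}a_{m−1} Y)) dc = (c_n(b)/(n+1))^m U_n(a₀(X a₀⋯a_{m−1} Y))`. [folklore] -/
theorem su2_integral_prod_exp_mul_chebyshevU_chain {b : ℝ} (hb : 0 ≤ b) (n : ℕ) :
    ∀ (m : ℕ) (a : Fin m → Matrix.specialUnitaryGroup (Fin 2) ℂ) (X Y : Matrix.specialUnitaryGroup (Fin 2) ℂ),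
      ∫ y : Fin m → Matrix.specialUnitaryGroup (Fin 2) ℂ, (∏ t, Real.exp (b * su2a0 (y t))) *
          (U ℝ n).eval (su2a0 (X * (List.ofFn fun t => y t * a t).prod * Y))
          ∂(Measure.pi fun _ => haarProbability (Matrix.specialUnitaryGroup (Fin 2) ℂ)) =
        ((besselI n b - besselI (n + 2) b) / (n + 1)) ^ m * (U ℝ n).eval (su2a0 (X * (List.ofFn a).prod * Y))
  | 0, a, X, Y => by
    simp [List.ofFn_zero, measureReal_def]
  | m + 1, a, X, Y => by
    set μ := haarProbability (Matrix.specialUnitaryGroup (Fin 2) ℂ) with hμ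
    have e := measurePreserving_piFinSuccAbove (fun _ : Fin (m + 1) => μ) 0
    rw [← e.symm.integral_comp' (g := fun y : Fin (m + 1) → Matrix.specialUnitaryGroup (Fin 2) ℂ =>
      (∏ t, Real.exp (b * su2a0 (y t))) * (U ℝ n).eval (su2a0 (X * (List.ofFn fun t => y t * a t).prod * Y)))]
    have hsymm : ∀ x : Matrix.specialUnitaryGroup (Fin 2) ℂ × (Fin m → Matrix.specialUnitaryGroup (Fin 2) ℂ),
        (MeasurableEquiv.piFinSuccAbove (fun _ : Fin (m + 1) => Matrix.specialUnitaryGroup (Fin 2) ℂ) 0).symm x =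
          Fin.cons x.1 x.2 := by
      intro x
      rw [MeasurableEquiv.piFinSuccAbove_symm_apply]
      simp [Fin.insertNthEquiv, Fin.insertNth_zero']
    have hG : ∀ x : Matrix.specialUnitaryGroup (Fin 2) ℂ × (Fin m → Matrix.specialUnitaryGroup (Fin 2) ℂ),
        (fun y : Fin (m + 1) → Matrix.specialUnitaryGroup (Fin 2) ℂ =>
          (∏ t, Real.exp (b * su2a0 (y t))) * (U ℝ n).eval (su2a0 (X * (List.ofFn fun t => y t * a t).prod * Y)))
          ((MeasurableEquiv.piFinSuccAbove (fun _ : Fin (m + 1) => Matrix.specialUnitaryGroup (Fin 2) ℂ) 0).symm x) =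
        Real.exp (b * su2a0 x.1) * ((∏ t, Real.exp (b * su2a0 (x.2 t))) *
          (U ℝ n).eval (su2a0 ((X * x.1 * a 0) * (List.ofFn fun t => x.2 t * a t.succ).prod * Y))) := by
      intro x
      rw [hsymm]
      simp only [Fin.prod_univ_succ, Fin.cons_zero, Fin.cons_succ, List.ofFn_succ, List.prod_cons]
      simp only [mul_assoc]
    simp_rw [hG]
    have hFc : Continuous fun x : Matrix.specialUnitaryGroup (Fin 2) ℂ × (Fin m → Matrix.specialUnitaryGroup (Fin 2) ℂ) =>
        Real.exp (b * su2a0 x.1) * ((∏ t, Real.exp (b * su2a0 (x.2 t))) *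
          (U ℝ n).eval (su2a0 ((X * x.1 * a 0) * (List.ofFn fun t => x.2 t * a t.succ).prod * Y))) := by
      have h1 : Continuous fun x : Matrix.specialUnitaryGroup (Fin 2) ℂ × (Fin m → Matrix.specialUnitaryGroup (Fin 2) ℂ) =>
          X * x.1 * a 0 := (continuous_const.mul continuous_fst).mul continuous_const
      have h2 : Continuous fun x : Matrix.specialUnitaryGroup (Fin 2) ℂ × (Fin m → Matrix.specialUnitaryGroup (Fin 2) ℂ) =>
          (List.ofFn fun t => x.2 t * a t.succ).prod :=
        (continuous_ofFn_mul_prod m (fun t => a t.succ)).comp continuous_snd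
      exact (Real.continuous_exp.comp (continuous_const.mul (continuous_su2a0.comp continuous_fst))).mul
        ((continuous_finsetProd _ fun t _ =>
          Real.continuous_exp.comp (continuous_const.mul (continuous_su2a0.comp ((continuous_apply t).comp continuous_snd)))).mul
          ((U ℝ n).continuous.comp (continuous_su2a0.comp ((h1.mul h2).mul continuous_const))))
    have hInt : Integrable (fun x : Matrix.specialUnitaryGroup (Fin 2) ℂ × (Fin m → Matrix.specialUnitaryGroup (Fin 2) ℂ) =>
        Real.exp (b * su2a0 x.1) * ((∏ t, Real.exp (b * su2a0 (x.2 t))) *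
          (U ℝ n).eval (su2a0 ((X * x.1 * a 0) * (List.ofFn fun t => x.2 t * a t.succ).prod * Y))))
        (μ.prod (Measure.pi fun _ : Fin m => μ)) :=
      hFc.integrable_of_hasCompactSupport (HasCompactSupport.of_compactSpace _)
    rw [integral_prod _ hInt]
    have hinner : ∀ x : Matrix.specialUnitaryGroup (Fin 2) ℂ,
        ∫ y : Fin m → Matrix.specialUnitaryGroup (Fin 2) ℂ, Real.exp (b * su2a0 x) * ((∏ t, Real.exp (b * su2a0 (y t))) *
          (U ℝ n).eval (su2a0 ((X * x * a 0) * (List.ofFn fun t => y t * a t.succ).prod * Y)))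
          ∂(Measure.pi fun _ : Fin m => μ) =
        Real.exp (b * su2a0 x) * (((besselI n b - besselI (n + 2) b) / (n + 1)) ^ m *
          (U ℝ n).eval (su2a0 ((X * x * a 0) * (List.ofFn fun t => a t.succ).prod * Y))) := by
      intro x
      rw [integral_const_mul, su2_integral_prod_exp_mul_chebyshevU_chain hb n m (fun t => a t.succ) (X * x * a 0) Y]
    simp_rw [hinner]
    -- outer integral: cyclicity `a₀(X x Q) = a₀(x (Q X))` and the one-step rule
    have hout : ∀ x : Matrix.specialUnitaryGroup (Fin 2) ℂ,
        Real.exp (b * su2a0 x) * (((besselI n b - besselI (n + 2) b) / (n + 1)) ^ m *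
          (U ℝ n).eval (su2a0 ((X * x * a 0) * (List.ofFn fun t => a t.succ).prod * Y))) =
        ((besselI n b - besselI (n + 2) b) / (n + 1)) ^ m * (Real.exp (b * su2a0 x) *
          (U ℝ n).eval (su2a0 (x * ((a 0 * (List.ofFn fun t => a t.succ).prod * Y) * X)))) := by
      intro x
      have hcyc : su2a0 ((X * x * a 0) * (List.ofFn fun t => a t.succ).prod * Y) =
          su2a0 (x * ((a 0 * (List.ofFn fun t => a t.succ).prod * Y) * X)) := by
        rw [show (X * x * a 0) * (List.ofFn fun t => a t.succ).prod * Y =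
          X * (x * ((a 0 * (List.ofFn fun t => a t.succ).prod * Y))) by simp only [mul_assoc], su2a0_mul_comm]
        simp only [mul_assoc]
      rw [hcyc]
      ring
    simp_rw [hout]
    rw [integral_const_mul, su2_integral_exp_mul_chebyshevU_mul hb n, List.ofFn_succ, List.prod_cons]
    have hcyc2 : su2a0 ((a 0 * (List.ofFn fun t => a t.succ).prod * Y) * X) =
        su2a0 (X * (a 0 * (List.ofFn fun i : Fin m => a i.succ).prod) * Y) := by
      rw [su2a0_mul_comm]
      simp only [mul_assoc]
    rw [hcyc2, pow_succ]
    ring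

variable {k : ℕ} {Ls : Fin k → ℕ} [∀ i, NeZero (Ls i)]

/-- **The character Haar chain on the rectangular slice**: for an injective `ℓ : Fin m → links` and `b ≥ 0`,
`∫ (∏_e e^{b a₀(c_e)}) U_n(a₀(∏ₜ c_{ℓ t} aₜ)) dc = (∫ e^{b a₀})^{N−m} (c_n(b)/(n+1))^m U_n(a₀(∏ₜ aₜ))` (links off the family
integrate out, links on it form the chain). [folklore] -/
theorem su2_integral_prod_exp_mul_chebyshevU_rectLine {b : ℝ} (hb : 0 ≤ b) (n : ℕ) {m : ℕ}
    (ℓ : Fin m → RectTorusSite Ls × Fin k) (hℓ : Injective ℓ) (a : Fin m → Matrix.specialUnitaryGroup (Fin 2) ℂ) :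
    ∫ c, (∏ e : RectTorusSite Ls × Fin k, Real.exp (b * su2a0 (c e))) *
        (U ℝ n).eval (su2a0 ((List.ofFn fun t => c (ℓ t) * a t).prod))
        ∂(rectSliceMeasure (Matrix.specialUnitaryGroup (Fin 2) ℂ) Ls) =
      (∫ g, Real.exp (b * su2a0 g) ∂haarProbability (Matrix.specialUnitaryGroup (Fin 2) ℂ)) ^
          (Fintype.card (RectTorusSite Ls × Fin k) - m) *
        ((besselI n b - besselI (n + 2) b) / (n + 1)) ^ m * (U ℝ n).eval (su2a0 ((List.ofFn a).prod)) := by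
  classical
  set s : Set (RectTorusSite Ls × Fin k) := Set.range ℓ with hs
  set e : Fin m ⊕ ↥sᶜ ≃ RectTorusSite Ls × Fin k :=
    (Equiv.sumCongr (Equiv.ofInjective ℓ hℓ) (Equiv.refl _)).trans (Equiv.Set.sumCompl s) with he
  have he1 : ∀ t : Fin m, e (Sum.inl t) = ℓ t := fun t => by
    simp [he, Equiv.Set.sumCompl_apply_inl]
  set f : (Fin m → Matrix.specialUnitaryGroup (Fin 2) ℂ) → ℝ :=
    fun y => (U ℝ n).eval (su2a0 ((List.ofFn fun t => y t * a t).prod)) with hf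
  have h1 : (fun c : RectSlice Ls (Matrix.specialUnitaryGroup (Fin 2) ℂ) =>
      (∏ e : RectTorusSite Ls × Fin k, Real.exp (b * su2a0 (c e))) *
        (U ℝ n).eval (su2a0 ((List.ofFn fun t => c (ℓ t) * a t).prod))) =
      fun c => f (fun i => c (e (Sum.inl i))) *
        ∏ t : RectTorusSite Ls × Fin k, (fun _ : RectTorusSite Ls × Fin k => fun g => Real.exp (b * su2a0 g)) t (c t) := by
    funext c
    simp only [hf, he1, mul_comm]
  rw [h1, slab_integral_pi_window_one (haarProbability (Matrix.specialUnitaryGroup (Fin 2) ℂ)) e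
    (fun _ : RectTorusSite Ls × Fin k => fun g => Real.exp (b * su2a0 g)) f]
  have h2 : ∫ y : Fin m → Matrix.specialUnitaryGroup (Fin 2) ℂ,
      f y * ∏ i, (fun _ : RectTorusSite Ls × Fin k => fun g : Matrix.specialUnitaryGroup (Fin 2) ℂ =>
        Real.exp (b * su2a0 g)) (e (Sum.inl i)) (y i)
      ∂(Measure.pi fun _ => haarProbability (Matrix.specialUnitaryGroup (Fin 2) ℂ)) =
      ((besselI n b - besselI (n + 2) b) / (n + 1)) ^ m * (U ℝ n).eval (su2a0 ((List.ofFn a).prod)) := by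
    simp only [hf]
    simp_rw [mul_comm ((U ℝ n).eval _) (∏ i : Fin m, Real.exp _)]
    have h := su2_integral_prod_exp_mul_chebyshevU_chain hb n m a 1 1
    simp only [one_mul, mul_one] at h
    exact h
  rw [h2, Finset.prod_const, Finset.card_univ]
  have hcard : Fintype.card ↥sᶜ = Fintype.card (RectTorusSite Ls × Fin k) - m := by
    rw [Fintype.card_compl_set, Set.card_range_of_injective hℓ, Fintype.card_fin]
  rw [hcard]
  ring

end SU2Chain

end Summit.Ventures.YMGap.FlowData
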